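import Mathlib
import Literature.Probability.RandomPlanarGeometry.ConformalMap
import HarnessLib

/-!
# Negative knowledge on crux `BoundaryClosure` — the corridor refutation of `HexObservableLimit`, part 1: the upper half unit disc as a Dobrushin (marked Jordan) domain, flat at the marked point `0`.

Support for `SAWDefectDecoherenceHexObservableLimitRefutation.lean` (item stmt-CriticalPhenomena-5420, the conclusion of
crux `BoundaryClosure`, stmt-CriticalPhenomena-8536). Everything proved. [folklore]
-/

noncomputable section

open Set Filter Topology Complex
open Literature.Probability.RandomPlanarGeometry
open UpperHalfPlane (upperHalfPlaneSet)

namespace Summit.CriticalPhenomena.SAWScalingLimit.Theorems.BoundaryClosure.Negative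

/-! ### The upper half unit disc -/

/-- The upper half unit disc. [folklore] -/
def HD : Set ℂ := {z | ‖z‖ < 1 ∧ 0 < z.im}

/-- The half-disc as an intersection of a ball and a half-plane. [folklore] -/
theorem HD_eq : HD = Metric.ball (0 : ℂ) 1 ∩ {z : ℂ | 0 < z.im} := by
  ext z; simp [HD, Metric.mem_ball, dist_zero_right]

/-- The half-disc is open. [folklore] -/
theorem isOpen_HD : IsOpen HD := by
  rw [HD_eq]; exact Metric.isOpen_ball.inter (isOpen_lt continuous_const Complex.continuous_im)

/-- The half-disc is convex. [folklore] -/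
theorem convex_HD : Convex ℝ HD := by
  rw [HD_eq]; exact (convex_ball _ _).inter (convex_halfSpace_im_gt 0)

/-- `i/2` lies in the half-disc. [folklore] -/
theorem I_half_mem_HD : Complex.I / 2 ∈ HD := by
  refine ⟨?_, ?_⟩
  · rw [norm_div, Complex.norm_I]; norm_num
  · simp

/-- The closure of the half-disc is the closed upper half disc. [folklore] -/
theorem closure_HD : closure HD = {z | ‖z‖ ≤ 1 ∧ 0 ≤ z.im} := by
  apply Subset.antisymm
  · refine closure_minimal (fun z hz => ⟨hz.1.le, hz.2.le⟩) ?_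
    exact (isClosed_le continuous_norm continuous_const).inter
      (isClosed_le continuous_const Complex.continuous_im)
  · rintro z ⟨hz1, hz2⟩
    -- `z` is the limit of `(1-ε) z + ε (i/2) ∈ HD` as `ε → 0⁺`
    have ht : Tendsto (fun ε : ℝ => ((1 - ε : ℝ) : ℂ) * z + (ε : ℂ) * (Complex.I / 2))
        (𝓝[>] 0) (𝓝 z) := by
      have : Continuous fun ε : ℝ => ((1 - ε : ℝ) : ℂ) * z + (ε : ℂ) * (Complex.I / 2) := by fun_prop
      have h := this.tendsto 0
      simp only [sub_zero, Complex.ofReal_one, one_mul, Complex.ofReal_zero, zero_mul, add_zero] at h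
      exact h.mono_left nhdsWithin_le_nhds
    refine mem_closure_of_tendsto ht ?_
    have hev : ∀ᶠ ε : ℝ in 𝓝[>] 0, 0 < ε ∧ ε < 1 := by
      have : Ioo (0:ℝ) 1 ∈ 𝓝[>] (0:ℝ) := Ioo_mem_nhdsGT one_pos
      exact Filter.eventually_of_mem this fun x hx => hx
    refine hev.mono fun ε ⟨h0, h1⟩ => ⟨?_, ?_⟩
    · calc ‖((1 - ε : ℝ) : ℂ) * z + (ε : ℂ) * (Complex.I / 2)‖
          ≤ ‖((1 - ε : ℝ) : ℂ) * z‖ + ‖(ε : ℂ) * (Complex.I / 2)‖ := norm_add_le _ _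
        _ = (1 - ε) * ‖z‖ + ε * (1 / 2) := by
          rw [norm_mul, norm_mul, Complex.norm_real, Complex.norm_real, Real.norm_of_nonneg (by linarith),
            Real.norm_of_nonneg h0.le, norm_div, Complex.norm_I]; norm_num
        _ < 1 := by nlinarith
    · simp only [Complex.add_im, Complex.mul_im, Complex.ofReal_re, Complex.ofReal_im, zero_mul, add_zero,
        Complex.div_ofNat_im, Complex.I_im, Complex.div_ofNat_re, Complex.I_re, zero_div, mul_zero]
      nlinarith

/-- The frontier of the half-disc: the closed upper semicircle and the diameter. [folklore] -/
theorem frontier_HD : frontier HD = {z | (‖z‖ = 1 ∧ 0 ≤ z.im) ∨ (z.im = 0 ∧ ‖z‖ ≤ 1)} := by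
  rw [frontier, isOpen_HD.interior_eq, closure_HD]
  ext z
  simp only [Set.mem_sdiff, mem_setOf_eq, HD]
  constructor
  · rintro ⟨⟨h1, h2⟩, h3⟩
    rcases h1.lt_or_eq with h1 | h1
    · right; exact ⟨(le_antisymm (not_lt.1 fun h => h3 ⟨h1, h⟩) h2), h1.le⟩
    · left; exact ⟨h1, h2⟩
  · rintro (⟨h1, h2⟩ | ⟨h1, h2⟩)
    · exact ⟨⟨h1.le, h2⟩, fun h => by linarith [h.1]⟩
    · exact ⟨⟨h2, h1.ge⟩, fun h => by linarith [h.2]⟩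

/-! ### The boundary loop -/

/-- One period of the boundary loop: the upper semicircle from `-1` to `1` for `s ∈ [0, 1/2]`,
then the diameter from `1` back to `-1` for `s ∈ [1/2, 1]`. [folklore] -/
def bdryFun (s : ℝ) : ℂ :=
  if s ≤ 1 / 2 then Complex.exp ((((1 - 2 * s) * Real.pi : ℝ) : ℂ) * Complex.I) else ((3 - 4 * s : ℝ) : ℂ)

/-- The boundary loop, `1`-periodic. [folklore] -/
def bdry (t : ℝ) : ℂ := bdryFun (Int.fract t)

/-- `bdryFun` is continuous. [folklore] -/
theorem continuous_bdryFun : Continuous bdryFun := by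
  unfold bdryFun
  refine Continuous.if_le ?_ ?_ continuous_id continuous_const ?_
  · fun_prop
  · fun_prop
  · rintro s rfl
    norm_num

/-- Values on the arc. [folklore] -/
theorem bdryFun_of_le {s : ℝ} (hs : s ≤ 1 / 2) :
    bdryFun s = Complex.exp ((((1 - 2 * s) * Real.pi : ℝ) : ℂ) * Complex.I) := by
  unfold bdryFun; rw [if_pos hs]

/-- Values on the diameter. [folklore] -/
theorem bdryFun_of_gt {s : ℝ} (hs : 1 / 2 < s) : bdryFun s = ((3 - 4 * s : ℝ) : ℂ) := by
  unfold bdryFun; rw [if_neg (not_le.2 hs)]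

/-- `bdryFun 0 = bdryFun 1 = -1`. [folklore] -/
theorem bdryFun_zero : bdryFun 0 = -1 := by
  rw [bdryFun_of_le (by norm_num)]
  simp [Complex.exp_pi_mul_I]

/-- `bdryFun 1 = -1`. [folklore] -/
theorem bdryFun_one : bdryFun 1 = -1 := by
  rw [bdryFun_of_gt (by norm_num)]; push_cast; norm_num

/-- The boundary loop is continuous. [folklore] -/
theorem continuous_bdry : Continuous bdry :=
  continuous_bdryFun.continuousOn.comp_fract'' (bdryFun_zero.trans bdryFun_one.symm)

/-- The boundary loop is `1`-periodic. [folklore] -/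
theorem periodic_bdry : Function.Periodic bdry 1 := fun t => by
  unfold bdry; rw [Int.fract_add_one]

/-- On `[0, 1)` the loop is `bdryFun`. [folklore] -/
theorem bdry_eq_of_mem {t : ℝ} (ht : t ∈ Ico (0:ℝ) 1) : bdry t = bdryFun t := by
  unfold bdry; rw [Int.fract_eq_self.2 ht]

/-- Norm and imaginary part on the arc. [folklore] -/
theorem arc_props {s : ℝ} (h0 : 0 ≤ s) (hs : s ≤ 1 / 2) :
    ‖bdryFun s‖ = 1 ∧ (bdryFun s).im = Real.sin ((1 - 2 * s) * Real.pi) ∧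
      (bdryFun s).re = Real.cos ((1 - 2 * s) * Real.pi) ∧ 0 ≤ (bdryFun s).im := by
  rw [bdryFun_of_le hs]
  refine ⟨Complex.norm_exp_ofReal_mul_I _, Complex.exp_ofReal_mul_I_im _, Complex.exp_ofReal_mul_I_re _, ?_⟩
  rw [Complex.exp_ofReal_mul_I_im]
  exact Real.sin_nonneg_of_nonneg_of_le_pi (by nlinarith [Real.pi_pos]) (by nlinarith [Real.pi_pos])

/-- The loop is injective on one period. [folklore] -/
theorem injOn_bdry : InjOn bdry (Ico 0 1) := by
  intro s hs t ht hst
  rw [bdry_eq_of_mem hs, bdry_eq_of_mem ht] at hst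
  -- the arc points have `im ≥ 0` and norm `1`; the open diameter points have `im = 0`, norm `< 1`
  have diam : ∀ u : ℝ, 1 / 2 < u → u < 1 → (bdryFun u).im = 0 ∧ ‖bdryFun u‖ < 1 := by
    intro u h1 h2
    rw [bdryFun_of_gt h1]
    refine ⟨Complex.ofReal_im _, ?_⟩
    rw [Complex.norm_real, Real.norm_eq_abs, abs_lt]; constructor <;> linarith
  by_cases hs2 : s ≤ 1 / 2 <;> by_cases ht2 : t ≤ 1 / 2
  · -- both on the arc: `cos` is injective on `[0, π]`
    obtain ⟨-, -, hres, -⟩ := arc_props hs.1 hs2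
    obtain ⟨-, -, hret, -⟩ := arc_props ht.1 ht2
    have hre := congrArg Complex.re hst
    rw [hres, hret] at hre
    have hπ := Real.pi_pos
    have a1 : 0 ≤ (1 - 2 * s) * Real.pi := mul_nonneg (by linarith) hπ.le
    have a2 : (1 - 2 * s) * Real.pi ≤ Real.pi := mul_le_of_le_one_left hπ.le (by linarith [hs.1])
    have b1 : 0 ≤ (1 - 2 * t) * Real.pi := mul_nonneg (by linarith) hπ.le
    have b2 : (1 - 2 * t) * Real.pi ≤ Real.pi := mul_le_of_le_one_left hπ.le (by linarith [ht.1])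
    have := Real.injOn_cos ⟨a1, a2⟩ ⟨b1, b2⟩ hre
    nlinarith
  · exfalso
    push Not at ht2
    obtain ⟨hn, -⟩ := arc_props hs.1 hs2
    have := (diam t ht2 ht.2).2
    rw [← hst, hn] at this; exact lt_irrefl _ this
  · exfalso
    push Not at hs2
    obtain ⟨hn, -⟩ := arc_props ht.1 ht2
    have := (diam s hs2 hs.2).2
    rw [hst, hn] at this; exact lt_irrefl _ this
  · push Not at hs2 ht2
    rw [bdryFun_of_gt hs2, bdryFun_of_gt ht2, Complex.ofReal_inj] at hst
    linarith

/-- The image of one period is the frontier of the half-disc. [folklore] -/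
theorem range_bdry : range bdry = frontier HD := by
  rw [frontier_HD]
  apply Subset.antisymm
  · rintro _ ⟨t, rfl⟩
    unfold bdry
    set s := Int.fract t with hs
    have h0 : 0 ≤ s := Int.fract_nonneg t
    have h1 : s < 1 := Int.fract_lt_one t
    by_cases hs2 : s ≤ 1 / 2
    · obtain ⟨hn, -, -, him⟩ := arc_props h0 hs2
      exact Or.inl ⟨hn, him⟩
    · push Not at hs2
      rw [bdryFun_of_gt hs2]
      refine Or.inr ⟨Complex.ofReal_im _, ?_⟩
      rw [Complex.norm_real, Real.norm_eq_abs, abs_le]; constructor <;> linarith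
  · rintro z (⟨hz1, hz2⟩ | ⟨hz1, hz2⟩)
    · -- arc: `z = exp(iθ)`, `θ = arg z ∈ [0, π]`, parameter `s = (1 - θ/π)/2`
      have harg0 : 0 ≤ Complex.arg z := Complex.arg_nonneg_iff.2 hz2
      have hargπ : Complex.arg z ≤ Real.pi := Complex.arg_le_pi z
      set s : ℝ := (1 - Complex.arg z / Real.pi) / 2 with hs
      have hs0 : 0 ≤ s := by
        rw [hs]; have : Complex.arg z / Real.pi ≤ 1 := (div_le_one Real.pi_pos).2 hargπ
        linarith
      have hs2 : s ≤ 1 / 2 := by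
        rw [hs]; have : 0 ≤ Complex.arg z / Real.pi := div_nonneg harg0 Real.pi_pos.le
        linarith
      refine ⟨s, ?_⟩
      rw [bdry_eq_of_mem ⟨hs0, by linarith⟩, bdryFun_of_le hs2]
      have e : (1 - 2 * s) * Real.pi = Complex.arg z := by
        rw [hs]; field_simp; ring
      rw [e]
      have := Complex.norm_mul_exp_arg_mul_I z
      rw [hz1, Complex.ofReal_one, one_mul] at this
      exact this
    · -- diameter: `z = x ∈ [-1, 1]`, parameter `s = (3 - x)/4 ∈ [1/2, 1]`
      have hre : |z.re| ≤ 1 := (Complex.abs_re_le_norm z).trans hz2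
      rw [abs_le] at hre
      have hz : z = ((z.re : ℝ) : ℂ) := by
        apply Complex.ext <;> simp [hz1]
      rcases eq_or_lt_of_le hre.1 with hm1 | hm1
      · -- `z = -1 = bdry 0`
        refine ⟨0, ?_⟩
        rw [bdry_eq_of_mem ⟨le_rfl, one_pos⟩, bdryFun_zero, hz, ← hm1]; push_cast; ring
      · set s : ℝ := (3 - z.re) / 4 with hs
        have hs1 : 1 / 2 < s ∨ z.re = 1 := by
          rcases eq_or_lt_of_le hre.2 with h | h
          · exact Or.inr h
          · left; rw [hs]; linarith
        rcases hs1 with hs1 | hone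
        · refine ⟨s, ?_⟩
          rw [bdry_eq_of_mem ⟨by rw [hs]; linarith, by rw [hs]; linarith⟩, bdryFun_of_gt hs1, hz]
          congr 1; rw [hs]; ring
        · -- `z = 1 = bdry (1/2)`
          refine ⟨1 / 2, ?_⟩
          rw [bdry_eq_of_mem ⟨by norm_num, by norm_num⟩, bdryFun_of_le le_rfl, hz, hone]
          norm_num

/-- The half-disc is bounded. [folklore] -/
theorem isBounded_HD : Bornology.IsBounded HD := by
  rw [HD_eq]; exact Metric.isBounded_ball.subset inter_subset_left

/-- The half-disc is connected. [folklore] -/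
theorem isConnected_HD : IsConnected HD := (convex_HD.isPathConnected ⟨_, I_half_mem_HD⟩).isConnected

/-- **The upper half unit disc as a Jordan domain.** [folklore] -/
def halfDiscJordan : JordanDomain where
  carrier := HD
  boundary := bdry
  isOpen := isOpen_HD
  isBounded := isBounded_HD
  isConnected := isConnected_HD
  continuous_boundary := continuous_bdry
  periodic_boundary := periodic_bdry
  injOn_boundary := injOn_bdry
  range_boundary := range_bdry

/-- **The half-disc with marked points `r ∈ (0,1)` and `0`** (a Dobrushin domain). [folklore] -/
def halfDiscDomain (r : ℝ) (hr : 0 < r ∧ r < 1) : DobrushinDomain where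
  toJordanDomain := halfDiscJordan
  mark := ![(3 - r) / 4, 3 / 4]
  strictMono_mark := by
    refine Fin.strictMono_iff_lt_succ.2 fun k => ?_
    fin_cases k
    simp; linarith [hr.1]
  mark_mem k := by
    fin_cases k
    · simp; constructor <;> linarith [hr.1, hr.2]
    · simp; norm_num

/-- The first marked point is `r`. [folklore] -/
theorem pt_zero_halfDiscDomain (r : ℝ) (hr : 0 < r ∧ r < 1) : (halfDiscDomain r hr).pt 0 = (r : ℂ) := by
  show bdry ((3 - r) / 4) = r
  rw [bdry_eq_of_mem ⟨by linarith [hr.2], by linarith [hr.1]⟩, bdryFun_of_gt (by linarith [hr.2])]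
  push_cast; ring

/-- The second marked point is `0`. [folklore] -/
theorem pt_one_halfDiscDomain (r : ℝ) (hr : 0 < r ∧ r < 1) : (halfDiscDomain r hr).pt 1 = 0 := by
  show bdry (3 / 4) = 0
  rw [bdry_eq_of_mem ⟨by norm_num, by norm_num⟩, bdryFun_of_gt (by norm_num)]
  push_cast; norm_num

/-- **Flatness at `0`**: near `0` the half-disc is the upper half-plane. [folklore] -/
theorem HD_inter_ball : HD ∩ Metric.ball (0 : ℂ) (1 / 2) = {z : ℂ | (0 : ℂ).im < z.im} ∩ Metric.ball (0 : ℂ) (1 / 2) := by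
  ext z
  simp only [HD, mem_inter_iff, mem_setOf_eq, Metric.mem_ball, dist_zero_right, Complex.zero_im]
  constructor
  · rintro ⟨⟨-, h⟩, h'⟩; exact ⟨h, h'⟩
  · rintro ⟨h, h'⟩; exact ⟨⟨by linarith, h⟩, h'⟩



end Summit.CriticalPhenomena.SAWScalingLimit.Theorems.BoundaryClosure.Negative
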